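import Summits.NavierStokesRegularity.NavierStokesRegularity.Theorems.AxisymmetricExtremalityAxisymmetricKatoGlobalStubSeregin2020TypeIILemma22ExcisionDriftError
import HarnessLib

/-!
# L22-B, excision-error package (kits/A1-hErrPkg.lean): accounting of time-INTEGRAL weights over
# the active pieces of a partition, and the global (e2) drift-error sum

Seregin 2020 Lemma 2.2 ⇐ Nazarov–Uraltseva 2012 Lemma 4.2 for the class `𝒱` (cell pub/ns-inputs, kits
A1 / A1-L22B-F3 / A1-hErrPkg). The energy class of the normalised pair across the axis and the singular
set `S` (`energyClass_acrossAxis_of_classV_of_excisionErrors`, seat ser-b) is proved modulo the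
excision-error package `hErrPkg`: for every cover of `S ∩ K` by parabolic cylinders `Q(z_i, r_i)` with
`Σ r_i ≤ ε` and every time partition, the three excision errors (kit F3b.4 (e1) gradient, (e2) drift,
(e3) axis) summed over the pieces are `≤ ω(ε) → 0`. This file supplies the (e2) DRIFT part of the
package with the linear modulus `C ε`:

* `sum_active_setIntegral_prod_le` — the integral-weight version of the active-piece accounting
  (`sum_activeLength_le` / `sum_steps_active_weight_le`, seat es-p1): the steps `[τ m, τ (m+1)] × B`
  active for `[c, d]` carry at most `∫∫_{([c,d] ∩ [τ 0, τ p]) × B} F` for `F ≥ 0`;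
* `volumeReal_activeSlab_ballStep_le`, `setIntegral_norm_le_cube_holder_of_subset` — the volume of an
  active slab `× B(x, 4r)` (`≤ 256 |B₁| r³`) and Hölder `∫_E |U| ≤ ‖U‖_{L³} |E|^{2/3}` (on seat ser-c's
  `lintegral_enorm_le_cube_holder`);
* `excision_driftError_sum_le` — conjuncts 2 and 5 of `hErrPkg`: per-step integrability of the drift
  excision error and `Σ_m ∫∫ η H(Φ) |⟪U, Θ² ∇(φ_m)²⟫| ≤ C ε`, from the per-piece bound
  `excision_driftError_le` (seat ser-c).

[cite: NazarovUraltseva2012, §3 (3.9), Remark 9, Lemma 4.2; Seregin2020, Lemma 2.2, §3]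

Proving this input makes the conditional line unconditional AS TYPED; no Navier–Stokes regularity
statement is proved here.
-/

-- the problem directory repeats the summit name (D-0017); core's `dupNamespace` linter fires
set_option linter.dupNamespace false

noncomputable section

open MeasureTheory Set Function Filter Topology TopologicalSpace Metric
open scoped NNReal ENNReal InnerProductSpace RealInnerProductSpace

namespace Summit.NavierStokesRegularity.NavierStokesRegularity.Theorems.AxisymmetricKatoGlobal.EulerScaling

/-- **Active pieces of a partition carry at most the integral over the enlarged interval.** For an
increasing `τ`, a slab `B` and an integrand `F ≥ 0` integrable on `(Icc c d ∩ Icc (τ 0) (τ p)) ×ˢ B`,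
the integrals of `F` over the steps `Icc (τ m) (τ (m+1)) ×ˢ B`, `m < p`, that are ACTIVE for `[c, d]`
(`c ≤ τ m`, `τ (m+1) ≤ d`) sum to at most the integral over `(Icc c d ∩ Icc (τ 0) (τ p)) ×ˢ B`: the
half-open steps are pairwise disjoint and differ from the closed ones by null sets. (The weight version
with `(τ (m+1) - τ m) · g` is `sum_activeLength_le` / `sum_steps_active_weight_le`.) [folklore] -/
theorem sum_active_setIntegral_prod_le {Y : Type*} [MeasureSpace Y] [SFinite (volume : Measure Y)]
    {τ : ℕ → ℝ} (hτ : Monotone τ) (p : ℕ) (c d : ℝ) {B : Set Y} (hB : MeasurableSet B)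
    {F : ℝ × Y → ℝ} (hF0 : ∀ w, 0 ≤ F w)
    (hFi : IntegrableOn F ((Icc c d ∩ Icc (τ 0) (τ p)) ×ˢ B) volume) :
    ∑ m ∈ (Finset.range p).filter (fun m => c ≤ τ m ∧ τ (m + 1) ≤ d),
        ∫ w in Icc (τ m) (τ (m + 1)) ×ˢ B, F w
      ≤ ∫ w in (Icc c d ∩ Icc (τ 0) (τ p)) ×ˢ B, F w := by
  classical
  set Fm := (Finset.range p).filter (fun m => c ≤ τ m ∧ τ (m + 1) ≤ d) with hFm
  -- each active closed step lies in the container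
  have hsub : ∀ m ∈ Fm, Icc (τ m) (τ (m + 1)) ⊆ Icc c d ∩ Icc (τ 0) (τ p) := by
    intro m hm
    obtain ⟨hmp, hcm, hmd⟩ := Finset.mem_filter.1 hm
    have hmp' : m + 1 ≤ p := Nat.succ_le_of_lt (Finset.mem_range.1 hmp)
    intro x hx
    exact ⟨⟨hcm.trans hx.1, hx.2.trans hmd⟩, (hτ (Nat.zero_le m)).trans hx.1, hx.2.trans (hτ hmp')⟩
  -- closed step = half-open step almost everywhere
  have hae : ∀ m, (Icc (τ m) (τ (m + 1)) ×ˢ B : Set (ℝ × Y)) =ᵐ[volume]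
      (Ico (τ m) (τ (m + 1)) ×ˢ B : Set (ℝ × Y)) := fun m => by
    rw [Measure.volume_eq_prod]
    exact Measure.set_prod_ae_eq Ico_ae_eq_Icc.symm (ae_eq_refl B)
  have hstep : ∀ m ∈ Fm, ∫ w in Icc (τ m) (τ (m + 1)) ×ˢ B, F w = ∫ w in Ico (τ m) (τ (m + 1)) ×ˢ B, F w :=
    fun m _ => setIntegral_congr_set (hae m)
  rw [Finset.sum_congr rfl hstep]
  -- the half-open steps are pairwise disjoint
  have hdisj : Set.Pairwise (↑Fm : Set ℕ) (Disjoint on fun m => (Ico (τ m) (τ (m + 1)) ×ˢ B : Set (ℝ × Y))) := by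
    intro m _ m' _ hne
    refine Set.disjoint_prod.2 (Or.inl ?_)
    rcases lt_or_gt_of_ne hne with h | h
    · exact Set.disjoint_left.2 fun x hx hx' => (not_lt.2 ((hτ (Nat.succ_le_of_lt h)).trans hx'.1)) hx.2
    · exact Set.disjoint_left.2 fun x hx hx' => (not_lt.2 ((hτ (Nat.succ_le_of_lt h)).trans hx.1)) hx'.2
  have hint : ∀ m ∈ Fm, IntegrableOn F (Ico (τ m) (τ (m + 1)) ×ˢ B) volume := fun m hm =>
    hFi.mono_set ((Set.prod_mono Ico_subset_Icc_self le_rfl).trans (Set.prod_mono (hsub m hm) le_rfl))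
  rw [← integral_biUnion_finset Fm (fun m _ => measurableSet_Ico.prod hB) hdisj hint]
  refine setIntegral_mono_set hFi (Eventually.of_forall fun w => hF0 w) (LE.le.eventuallyLE ?_)
  intro w hw
  obtain ⟨m, hm, hwm⟩ := mem_iUnion₂.1 hw
  exact ⟨hsub m hm (Ico_subset_Icc_self hwm.1), hwm.2⟩


open Literature.Analysis.FluidPDE Literature.Analysis.FluidPDE.Seregin2020

/-- Volume of `(Icc c d ∩ I) ×ˢ (ball x (4ρ) ∩ O)` for `d - c = 4ρ²`, `0 < ρ < 1`: at most
`256 |B(0,1)| ρ³` (real volume). [folklore] -/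
theorem volumeReal_activeSlab_ballStep_le (c : ℝ) (I : Set ℝ) (x : EuclideanSpace ℝ (Fin 3))
    (O : Set (EuclideanSpace ℝ (Fin 3))) {ρ : ℝ} (hρ : 0 < ρ) (hρ1 : ρ < 1) :
    volume.real ((Icc c (c + 4 * ρ ^ 2) ∩ I) ×ˢ (ball x (4 * ρ) ∩ O))
      ≤ 256 * volume.real (ball (0 : EuclideanSpace ℝ (Fin 3)) 1) * ρ ^ 3 := by
  have hB := Measure.addHaar_ball (volume : Measure (EuclideanSpace ℝ (Fin 3))) x (r := 4 * ρ) (by linarith)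
  rw [finrank_euclideanSpace_fin] at hB
  have hsub : (Icc c (c + 4 * ρ ^ 2) ∩ I) ×ˢ (ball x (4 * ρ) ∩ O) ⊆ Icc c (c + 4 * ρ ^ 2) ×ˢ ball x (4 * ρ) :=
    Set.prod_mono inter_subset_left inter_subset_left
  have hfin : volume (Icc c (c + 4 * ρ ^ 2) ×ˢ ball x (4 * ρ)) ≠ ⊤ := by
    rw [Measure.volume_eq_prod, Measure.prod_prod, Real.volume_Icc, hB]
    exact ENNReal.mul_ne_top ENNReal.ofReal_ne_top
      (ENNReal.mul_ne_top (by simp) measure_ball_lt_top.ne)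
  calc volume.real ((Icc c (c + 4 * ρ ^ 2) ∩ I) ×ˢ (ball x (4 * ρ) ∩ O))
      ≤ volume.real (Icc c (c + 4 * ρ ^ 2) ×ˢ ball x (4 * ρ)) := measureReal_mono hsub hfin
    _ = 4 * ρ ^ 2 * ((4 * ρ) ^ 3 * volume.real (ball (0 : EuclideanSpace ℝ (Fin 3)) 1)) := by
        rw [measureReal_def, Measure.volume_eq_prod, Measure.prod_prod, Real.volume_Icc, hB,
          ENNReal.toReal_mul, show c + 4 * ρ ^ 2 - c = 4 * ρ ^ 2 by ring,
          ENNReal.toReal_ofReal (by positivity), ENNReal.toReal_mul,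
          ENNReal.toReal_ofReal (by positivity), measureReal_def]
    _ = 256 * volume.real (ball (0 : EuclideanSpace ℝ (Fin 3)) 1) * ρ ^ 5 := by ring
    _ ≤ 256 * volume.real (ball (0 : EuclideanSpace ℝ (Fin 3)) 1) * ρ ^ 3 := by
        have hvB : 0 ≤ volume.real (ball (0 : EuclideanSpace ℝ (Fin 3)) 1) := measureReal_nonneg
        have : ρ ^ 5 ≤ ρ ^ 3 := pow_le_pow_of_le_one hρ.le hρ1.le (by norm_num)
        nlinarith [mul_le_mul_of_nonneg_left this hvB]

/-- **Hölder bound for the drift on one active slab.** For `U` measurable with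
`∫∫_{[t₁,t₂]×B(0,2R)} |U|³ < ∞` and `E ⊆ [t₁,t₂] × B(0,2R)` of real volume `≤ V`:
`∫_E ‖U‖ ≤ (∫∫_{[t₁,t₂]×B(0,2R)} |U|³)^{1/3} · V^{2/3}`. [folklore] -/
theorem setIntegral_norm_le_cube_holder_of_subset
    {U : ℝ → EuclideanSpace ℝ (Fin 3) → EuclideanSpace ℝ (Fin 3)} {R t₁ t₂ : ℝ}
    (hUm : AEStronglyMeasurable (uncurry U) volume)
    (hU3 : ∫⁻ z in Icc t₁ t₂ ×ˢ ball (0 : EuclideanSpace ℝ (Fin 3)) (2 * R), ‖U z.1 z.2‖ₑ ^ (3 : ℕ) < ⊤)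
    {E : Set (ℝ × EuclideanSpace ℝ (Fin 3))}
    (hE : E ⊆ Icc t₁ t₂ ×ˢ ball (0 : EuclideanSpace ℝ (Fin 3)) (2 * R)) {V : ℝ}
    (hV : volume.real E ≤ V) :
    IntegrableOn (fun z : ℝ × EuclideanSpace ℝ (Fin 3) => ‖U z.1 z.2‖) E volume ∧
    ∫ z in E, ‖U z.1 z.2‖ ≤
      ((∫⁻ z in Icc t₁ t₂ ×ˢ ball (0 : EuclideanSpace ℝ (Fin 3)) (2 * R), ‖U z.1 z.2‖ₑ ^ (3 : ℕ)) ^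
        (1 / 3 : ℝ)).toReal * V ^ (2 / 3 : ℝ) := by
  have hslab : volume (Icc t₁ t₂ ×ˢ ball (0 : EuclideanSpace ℝ (Fin 3)) (2 * R)) ≠ ⊤ := by
    rw [Measure.volume_eq_prod, Measure.prod_prod, Real.volume_Icc]
    exact ENNReal.mul_ne_top ENNReal.ofReal_ne_top measure_ball_lt_top.ne
  have hEfin : volume E ≠ ⊤ := (lt_of_le_of_lt (measure_mono hE) hslab.lt_top).ne
  have hU3E : ∫⁻ z in E, ‖U z.1 z.2‖ₑ ^ (3 : ℕ) < ⊤ := lt_of_le_of_lt (lintegral_mono_set hE) hU3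
  have hint : IntegrableOn (fun z : ℝ × EuclideanSpace ℝ (Fin 3) => U z.1 z.2) E volume :=
    integrableOn_of_lintegral_cube_lt_top hUm hU3E hEfin
  refine ⟨hint.norm, ?_⟩
  have hUmE : AEStronglyMeasurable (fun z : ℝ × EuclideanSpace ℝ (Fin 3) => U z.1 z.2) (volume.restrict E) :=
    hint.aestronglyMeasurable
  rw [integral_norm_eq_lintegral_enorm hUmE]
  have hV0 : 0 ≤ V := measureReal_nonneg.trans hV
  have h1 := lintegral_enorm_le_cube_holder (E := E) hUm
  have h2 : (∫⁻ z in E, ‖U z.1 z.2‖ₑ ^ (3 : ℕ)) ^ (1 / 3 : ℝ) ≤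
      (∫⁻ z in Icc t₁ t₂ ×ˢ ball (0 : EuclideanSpace ℝ (Fin 3)) (2 * R), ‖U z.1 z.2‖ₑ ^ (3 : ℕ)) ^ (1 / 3 : ℝ) :=
    ENNReal.rpow_le_rpow (lintegral_mono_set hE) (by norm_num)
  have h3 : volume E ^ (2 / 3 : ℝ) ≤ ENNReal.ofReal V ^ (2 / 3 : ℝ) := by
    refine ENNReal.rpow_le_rpow ?_ (by norm_num)
    rw [← ENNReal.ofReal_toReal hEfin]
    exact ENNReal.ofReal_le_ofReal hV
  have hfin : (∫⁻ z in Icc t₁ t₂ ×ˢ ball (0 : EuclideanSpace ℝ (Fin 3)) (2 * R), ‖U z.1 z.2‖ₑ ^ (3 : ℕ)) ^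
      (1 / 3 : ℝ) * ENNReal.ofReal V ^ (2 / 3 : ℝ) ≠ ⊤ :=
    ENNReal.mul_ne_top (ENNReal.rpow_ne_top_of_nonneg (by norm_num) hU3.ne)
      (ENNReal.rpow_ne_top_of_nonneg (by norm_num) ENNReal.ofReal_ne_top)
  calc (∫⁻ z in E, ‖U z.1 z.2‖ₑ).toReal
      ≤ ((∫⁻ z in Icc t₁ t₂ ×ˢ ball (0 : EuclideanSpace ℝ (Fin 3)) (2 * R), ‖U z.1 z.2‖ₑ ^ (3 : ℕ)) ^
          (1 / 3 : ℝ) * ENNReal.ofReal V ^ (2 / 3 : ℝ)).toReal :=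
        ENNReal.toReal_mono hfin (h1.trans (mul_le_mul' h2 h3))
    _ = _ := by
        rw [ENNReal.toReal_mul]
        congr 1
        rw [← ENNReal.toReal_rpow, ENNReal.toReal_ofReal hV0]

/-- **The global (e2) drift-error sum of the excision-error package** (kits/A1-hErrPkg.lean,
conjuncts 2 and 5 of `hErrPkg` with the linear modulus `ω ε = C ε`). For the fixed data
`(U, Φ, H, Θ, η, R, t₁, t₂)` of one energy-class test — `U` measurable with `|U|³` integrable on
`[t₁,t₂] × B(0,2R)`, `Φ ≥ 0` measurable, `H ∈ C²`, `H' ≤ 0 ≤ H`, `Θ ∈ C¹_c` supported in `B(0,2R)`,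
`η ∈ C¹`, `η ≥ 0` — there is `C ≥ 0` such that for every finite family of parabolic cylinders
`Q(z_i, r_i)`, `0 < r_i < 1`, `Σ r_i ≤ ε`, every partition `t₁ = τ 0 ≤ … ≤ τ p = t₂`, the active sets
`A m = {i : [τ m, τ (m+1)] ⊆ [t_i - 2r_i², t_i + 2r_i²]}` and the cut products
`φ m = ∏_{i ∈ A m} (1 - cutoff (2 r_i) (· - x_i))`, the drift excision errors
`η H(Φ) ⟪U, Θ² ∇(φ m)²⟫` are integrable on every step `[τ m, τ (m+1)] × ℝ³` and
`Σ_m ∫∫_{[τ m, τ(m+1)]×ℝ³} η H(Φ) |⟪U, Θ² ∇(φ m)²⟫| ≤ C ε`.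
Route: the per-piece bound `excision_driftError_le` (seat ser-c), the active-piece accounting
`sum_active_setIntegral_prod_le` (each ball is charged at most `∫∫_{[t_i-2r_i², t_i+2r_i²]×B(x_i,4r_i)} |U|`),
Hölder `∫_E |U| ≤ ‖U‖₃ |E|^{2/3}` with `|E| ≤ 256|B₁| r_i³`, and `r_i⁻¹ · r_i² = r_i`.
[cite: NazarovUraltseva2012, §3 (3.9), Remark 9; Seregin2020, Lemma 2.2, §3] -/
theorem excision_driftError_sum_le
    {U : ℝ → EuclideanSpace ℝ (Fin 3) → EuclideanSpace ℝ (Fin 3)} {Φ : ℝ → EuclideanSpace ℝ (Fin 3) → ℝ}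
    {H : ℝ → ℝ} {Θ : EuclideanSpace ℝ (Fin 3) → ℝ} {η : ℝ → ℝ} {R t₁ t₂ : ℝ}
    (hUm : AEStronglyMeasurable (uncurry U) volume)
    (hU3 : ∫⁻ z in Icc t₁ t₂ ×ˢ ball (0 : EuclideanSpace ℝ (Fin 3)) (2 * R), ‖U z.1 z.2‖ₑ ^ (3 : ℕ) < ⊤)
    (hΦm : Measurable (uncurry Φ)) (hΦ0 : ∀ t x, 0 ≤ Φ t x)
    (hH : ContDiff ℝ 2 H) (hH' : ∀ v, deriv H v ≤ 0) (hH0 : ∀ v, 0 ≤ H v)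
    (hΘ : ContDiff ℝ 1 Θ) (hΘc : HasCompactSupport Θ)
    (hΘs : tsupport Θ ⊆ ball (0 : EuclideanSpace ℝ (Fin 3)) (2 * R))
    (hη : ContDiff ℝ 1 η) (hη0 : ∀ s, 0 ≤ η s) :
    ∃ C : ℝ, 0 ≤ C ∧ ∀ (s : Finset ℕ) (z : ℕ → ℝ × EuclideanSpace ℝ (Fin 3)) (r : ℕ → ℝ) (ε : ℝ), 0 < ε →
      (∀ i ∈ s, 0 < r i ∧ r i < 1) → ∑ i ∈ s, r i ≤ ε →
      ∀ (p : ℕ) (τ : ℕ → ℝ), Monotone τ → τ 0 = t₁ → τ p = t₂ →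
      ∀ (A : ℕ → Finset ℕ), (∀ m, A m = s.filter fun i => (z i).1 - 2 * r i ^ 2 ≤ τ m ∧ τ (m + 1) ≤ (z i).1 + 2 * r i ^ 2) →
      ∀ (φ : ℕ → EuclideanSpace ℝ (Fin 3) → ℝ), (∀ m y, φ m y = ∏ i ∈ A m, (1 - cutoff (2 * r i) (y - (z i).2))) →
        (∀ m < p,
          Integrable (fun w : ℝ × EuclideanSpace ℝ (Fin 3) =>
              η w.1 * (H (Φ w.1 w.2) * inner ℝ (U w.1 w.2) ((Θ w.2 ^ 2) • gradient (fun y => φ m y ^ 2) w.2)))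
            (volume.restrict (Icc (τ m) (τ (m + 1)) ×ˢ (univ : Set (EuclideanSpace ℝ (Fin 3)))))) ∧
        (∑ m ∈ Finset.range p, ∫ w in Icc (τ m) (τ (m + 1)) ×ˢ (univ : Set (EuclideanSpace ℝ (Fin 3))),
            η w.1 * (H (Φ w.1 w.2) * |inner ℝ (U w.1 w.2) ((Θ w.2 ^ 2) • gradient (fun y => φ m y ^ 2) w.2)|))
          ≤ C * ε := by
  classical
  obtain ⟨C₀, hC₀, hbump⟩ := exists_ballBump_const
  obtain ⟨K, hK0, hK⟩ := excision_driftError_le hUm hU3 hΦm hΦ0 hH hH' hH0 hΘ hΘc hΘs hη hC₀.le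
  -- the constants
  set L : ℝ := ((∫⁻ z in Icc t₁ t₂ ×ˢ ball (0 : EuclideanSpace ℝ (Fin 3)) (2 * R), ‖U z.1 z.2‖ₑ ^ (3 : ℕ)) ^
    (1 / 3 : ℝ)).toReal with hL
  set vB : ℝ := volume.real (ball (0 : EuclideanSpace ℝ (Fin 3)) 1) with hvB
  have hL0 : 0 ≤ L := ENNReal.toReal_nonneg
  have hvB0 : 0 ≤ vB := measureReal_nonneg
  refine ⟨K * (L * (256 * vB) ^ (2 / 3 : ℝ)), by positivity, ?_⟩
  intro s z r ε hε hr hsum p τ hτ hτ0 hτp A hA φ hφ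
  -- the bumps of the cover
  set ψ : ℕ → EuclideanSpace ℝ (Fin 3) → ℝ := fun i y => cutoff (2 * r i) (y - (z i).2) with hψ
  have hφ2 : ∀ m, (fun y => φ m y ^ 2) = fun y => (∏ i ∈ A m, (1 - ψ i y)) ^ 2 := fun m => by
    funext y; rw [hφ m y]
  have hAs : ∀ m, A m ⊆ s := fun m => by rw [hA m]; exact Finset.filter_subset _ _
  have hψC : ∀ m, ∀ i ∈ A m, ContDiff ℝ 1 (ψ i) := fun m i hi => (hbump (z i).2 (r i) (hr i (hAs m hi)).1).1
  have hψ01 : ∀ m, ∀ i ∈ A m, ∀ y, 0 ≤ ψ i y ∧ ψ i y ≤ 1 := fun m i hi =>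
    (hbump (z i).2 (r i) (hr i (hAs m hi)).1).2.1
  have hψD : ∀ m, ∀ i ∈ A m, ∀ y, ‖fderiv ℝ (ψ i) y‖ ≤ C₀ / r i := fun m i hi =>
    (hbump (z i).2 (r i) (hr i (hAs m hi)).1).2.2.2.2.1
  have hψ0 : ∀ m, ∀ i ∈ A m, ∀ y, y ∉ ball (z i).2 (4 * r i) → fderiv ℝ (ψ i) y = 0 := fun m i hi =>
    (hbump (z i).2 (r i) (hr i (hAs m hi)).1).2.2.2.2.2
  have hrA : ∀ m, ∀ i ∈ A m, 0 < r i := fun m i hi => (hr i (hAs m hi)).1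
  -- the steps lie in `[t₁, t₂]`
  have hτ1 : ∀ m, t₁ ≤ τ m := fun m => hτ0 ▸ hτ (Nat.zero_le m)
  have hτ2 : ∀ m < p, τ (m + 1) ≤ t₂ := fun m hm => hτp ▸ hτ (Nat.succ_le_of_lt hm)
  -- the per-piece bound (e2)
  have hpiece : ∀ m < p,
      IntegrableOn (fun w : ℝ × EuclideanSpace ℝ (Fin 3) => η w.1 * (H (Φ w.1 w.2) *
          inner ℝ (U w.1 w.2) ((Θ w.2 ^ 2) • gradient (fun y => (∏ i ∈ A m, (1 - ψ i y)) ^ 2) w.2)))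
        (Icc (τ m) (τ (m + 1)) ×ˢ univ) volume ∧
      ∫ w in Icc (τ m) (τ (m + 1)) ×ˢ (univ : Set (EuclideanSpace ℝ (Fin 3))), |η w.1 * (H (Φ w.1 w.2) *
          inner ℝ (U w.1 w.2) ((Θ w.2 ^ 2) • gradient (fun y => (∏ i ∈ A m, (1 - ψ i y)) ^ 2) w.2))|
        ≤ K * ∑ i ∈ A m, (r i)⁻¹ *
          ∫ w in Icc (τ m) (τ (m + 1)) ×ˢ (ball (z i).2 (4 * r i) ∩ ball (0 : EuclideanSpace ℝ (Fin 3)) (2 * R)),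
            ‖U w.1 w.2‖ :=
    fun m hm => hK (A m) (fun i => (z i).2) r ψ (τ m) (τ (m + 1)) (hτ1 m) (hτ (Nat.le_succ m)) (hτ2 m hm)
      (hrA m) (hψC m) (hψ01 m) (hψD m) (hψ0 m)
  refine ⟨fun m hm => ?_, ?_⟩
  · rw [hφ2 m]; exact (hpiece m hm).1
  -- ### the sum
  -- |η (H ⟪U, Θ² ∇φ²⟫)| = η H |⟪U, Θ² ∇φ²⟫|
  have habs : ∀ m (w : ℝ × EuclideanSpace ℝ (Fin 3)),
      η w.1 * (H (Φ w.1 w.2) * |inner ℝ (U w.1 w.2) ((Θ w.2 ^ 2) • gradient (fun y => φ m y ^ 2) w.2)|) =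
      |η w.1 * (H (Φ w.1 w.2) *
          inner ℝ (U w.1 w.2) ((Θ w.2 ^ 2) • gradient (fun y => (∏ i ∈ A m, (1 - ψ i y)) ^ 2) w.2))| := by
    intro m w
    rw [hφ2 m, abs_mul, abs_mul, abs_of_nonneg (hη0 _), abs_of_nonneg (hH0 _)]
  have hstep1 : ∑ m ∈ Finset.range p, ∫ w in Icc (τ m) (τ (m + 1)) ×ˢ (univ : Set (EuclideanSpace ℝ (Fin 3))),
        η w.1 * (H (Φ w.1 w.2) * |inner ℝ (U w.1 w.2) ((Θ w.2 ^ 2) • gradient (fun y => φ m y ^ 2) w.2)|)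
      ≤ ∑ m ∈ Finset.range p, K * ∑ i ∈ A m, (r i)⁻¹ *
          ∫ w in Icc (τ m) (τ (m + 1)) ×ˢ (ball (z i).2 (4 * r i) ∩ ball (0 : EuclideanSpace ℝ (Fin 3)) (2 * R)),
            ‖U w.1 w.2‖ := by
    refine Finset.sum_le_sum fun m hm => ?_
    simp_rw [habs m]
    exact (hpiece m (Finset.mem_range.1 hm)).2
  refine hstep1.trans ?_
  -- exchange the sums: each ball is charged over its active steps only
  set c : ℕ → ℝ := fun i => (z i).1 - 2 * r i ^ 2 with hc
  set d : ℕ → ℝ := fun i => (z i).1 + 2 * r i ^ 2 with hd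
  set g : ℕ → ℕ → ℝ := fun i m =>
    ∫ w in Icc (τ m) (τ (m + 1)) ×ˢ (ball (z i).2 (4 * r i) ∩ ball (0 : EuclideanSpace ℝ (Fin 3)) (2 * R)),
      ‖U w.1 w.2‖ with hg
  have hexch : ∑ m ∈ Finset.range p, K * ∑ i ∈ A m, (r i)⁻¹ * g i m
      = K * ∑ i ∈ s, (r i)⁻¹ * ∑ m ∈ (Finset.range p).filter (fun m => c i ≤ τ m ∧ τ (m + 1) ≤ d i), g i m := by
    rw [← Finset.mul_sum]
    congr 1
    have : ∀ m, ∑ i ∈ A m, (r i)⁻¹ * g i m = ∑ i ∈ s, if c i ≤ τ m ∧ τ (m + 1) ≤ d i then (r i)⁻¹ * g i m else 0 := by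
      intro m; rw [hA m, Finset.sum_filter]
    simp_rw [this]
    rw [Finset.sum_comm]
    refine Finset.sum_congr rfl fun i _ => ?_
    rw [Finset.sum_filter, Finset.mul_sum]
    refine Finset.sum_congr rfl fun m _ => ?_
    split_ifs <;> simp
  rw [hexch]
  -- per ball: active accounting + Hölder
  have hball : ∀ i ∈ s, (r i)⁻¹ * ∑ m ∈ (Finset.range p).filter (fun m => c i ≤ τ m ∧ τ (m + 1) ≤ d i), g i m
      ≤ L * (256 * vB) ^ (2 / 3 : ℝ) * r i := by
    intro i hi
    obtain ⟨hri, hri1⟩ := hr i hi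
    set B : Set (EuclideanSpace ℝ (Fin 3)) := ball (z i).2 (4 * r i) ∩ ball (0 : EuclideanSpace ℝ (Fin 3)) (2 * R) with hB
    have hBm : MeasurableSet B := measurableSet_ball.inter measurableSet_ball
    set E : Set (ℝ × EuclideanSpace ℝ (Fin 3)) := (Icc (c i) (d i) ∩ Icc (τ 0) (τ p)) ×ˢ B with hE
    have hEsub : E ⊆ Icc t₁ t₂ ×ˢ ball (0 : EuclideanSpace ℝ (Fin 3)) (2 * R) := by
      rw [hE, hτ0, hτp]; exact Set.prod_mono inter_subset_right inter_subset_right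
    have hdc : d i = c i + 4 * r i ^ 2 := by rw [hc, hd]; ring
    have hvol : volume.real E ≤ 256 * vB * r i ^ 3 := by
      rw [hE, hdc, hB]
      exact volumeReal_activeSlab_ballStep_le (c i) (Icc (τ 0) (τ p)) (z i).2 _ hri hri1
    obtain ⟨hintE, hholder⟩ := setIntegral_norm_le_cube_holder_of_subset hUm hU3 hEsub hvol
    have hacc := sum_active_setIntegral_prod_le (Y := EuclideanSpace ℝ (Fin 3)) hτ p (c i) (d i) hBm
      (F := fun w : ℝ × EuclideanSpace ℝ (Fin 3) => ‖U w.1 w.2‖) (fun w => norm_nonneg _) hintE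
    have h23 : (256 * vB * r i ^ 3) ^ (2 / 3 : ℝ) = (256 * vB) ^ (2 / 3 : ℝ) * r i ^ 2 := by
      rw [Real.mul_rpow (by positivity) (by positivity)]
      congr 1
      rw [show ((r i) ^ 3 : ℝ) = (r i) ^ (3 : ℝ) by norm_cast, ← Real.rpow_mul hri.le]
      norm_num
    calc (r i)⁻¹ * ∑ m ∈ (Finset.range p).filter (fun m => c i ≤ τ m ∧ τ (m + 1) ≤ d i), g i m
        ≤ (r i)⁻¹ * (L * (256 * vB * r i ^ 3) ^ (2 / 3 : ℝ)) :=
          mul_le_mul_of_nonneg_left (hacc.trans hholder) (inv_nonneg.2 hri.le)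
      _ = L * (256 * vB) ^ (2 / 3 : ℝ) * r i := by
          rw [h23]; field_simp
  calc K * ∑ i ∈ s, (r i)⁻¹ * ∑ m ∈ (Finset.range p).filter (fun m => c i ≤ τ m ∧ τ (m + 1) ≤ d i), g i m
      ≤ K * ∑ i ∈ s, L * (256 * vB) ^ (2 / 3 : ℝ) * r i :=
        mul_le_mul_of_nonneg_left (Finset.sum_le_sum hball) hK0
    _ = K * (L * (256 * vB) ^ (2 / 3 : ℝ)) * ∑ i ∈ s, r i := by rw [← Finset.mul_sum]; ring
    _ ≤ K * (L * (256 * vB) ^ (2 / 3 : ℝ)) * ε :=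
        mul_le_mul_of_nonneg_left hsum (by positivity)

end Summit.NavierStokesRegularity.NavierStokesRegularity.Theorems.AxisymmetricKatoGlobal.EulerScaling

end
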